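import Literature.NumberTheory.NumberFields.QuadraticUnramifiedAtUnitPlace        -- ★ P6 (i) `isUnramifiedAt_of_sq_eq_of_not_mem` + `adjoin_eq_top_of_not_mem_range` (different road, odd places)
import Literature.NumberTheory.NumberFields.QuadraticExtensionDegreeOneSplitting   -- ★ `QuadraticExtension.mem_splitPrimes_of_isSquare_adicCompletion` (local squares split)
import HarnessLib

/-!
# R90-TF · S3 · THEOREMS — `R90S3UnramifiedOfUnitRadicand` ((U3-F) split, brick P6): `F(√m) ∕ F` is unramified above `u` when `m` is a square in `F_u`
# (any `u`), and above EVERY DYADIC place when `m = 1 + 4κ`, `κ ∈ 𝓞 F` — the dyadic half of ⟪U⟫-field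

R90-TF section S3 (successor dealer R90-C12-plan (g2), offer 2026-09-05T00:38:19Z «P6 in the REPAIRED form», memo `R90/R90-C12-plan/g2/DEAL-S3-U3F-SPLIT.v1.md` §1 row
P6 + audit1 S3#71 (B) «classes {1, 5} (mod 8), never split at 2»); crux H413 (`stmt-HodgeConjecture-24833`, lane `--supports … --as helper`), route `HCCMUnconditional`.
Serves the ⟪U⟫-field clause `∀ w′ ≠ v′, ∀ W ∣ w′, Algebra.IsUnramifiedAt (𝓞 L′⁺) W.1.asIdeal` of the (U3-F) socket `stub_R90_S3_auxGlobaliseField`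
(`Cruxes/H413/Lines/R90_S3_LocalTransportWaveG.lean` :645) through the assembly P8 (`L′ = F′(√α)`).  THEOREMS ONLY (no `def`, no `instance`, no notation, no named
fact, no `sorry`); ★ imports only; never imports `Cruxes/…/Lines`.

CENSUS (R90 bus 00:40:40Z).  The ODD-place half of P6 — «`m₀, 2 ∉ 𝔭_u` ⇒ `F(√m₀)` unramified at every `W ∣ u`» — is ALREADY ★ BY NAME:
`Literature.NumberTheory.NumberFields.isUnramifiedAt_of_sq_eq_of_not_mem` (`QuadraticUnramifiedAtUnitPlace` :187; `…isUnramifiedIn_of_sq_eq_of_not_mem` :222) and is NOT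
restated here.  This file adds the two pieces the dyadic places need.

THE MATHEMATICS [Neukirch1999 Ch. III §2 Thm. (2.6), (2.4)–(2.5); Ch. II (7.13); SerreLocalFields1979 Ch. III §6; Omeara1963 §63A, §65A].  `E ∕ F` a quadratic extension of
number fields, `δ ∈ E ∖ F`.
(§1) SPLIT ⇒ UNRAMIFIED, any `u`: if `δ² = m` and `m` is a square in the completion `F_u`, then `u` splits completely in `E` (★ `mem_splitPrimes_of_isSquare_adicCompletion`,
O'Meara §65A), in particular `Algebra.IsUnramifiedIn (𝓞 E) 𝔭_u` and `Algebra.IsUnramifiedAt (𝓞 F) 𝔓_W` for every `W ∣ u` — at a dyadic `u` of degree one over `ℚ₂` this is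
the class `m ≡ 1 (mod 8)`.
(§2) THE DYADIC UNIT CLASSES (`x`-version): if `δ² = m₁` and `x² − m₁ = 4κ` with `x, m₁, κ ∈ 𝓞 F`, then `θ := (x + δ)∕2` is an algebraic integer with
`minpoly_{𝓞 F} θ = X² − x X + κ` and `f′(θ) = 2θ − x = δ`, so `δ ∈ 𝔇(𝓞 E ∕ 𝓞 F)` (Mathlib `aeval_derivative_mem_differentIdeal`); if a prime `𝔓_W ∣ u` divided `𝔇`
(⟺ ramified, Mathlib `not_dvd_differentIdeal_iff`) then `δ² = m₁ ∈ 𝔓_W ∩ 𝓞 F = 𝔭_u`; hence `E` is UNRAMIFIED at every `W ∣ u` with `m₁ ∉ 𝔭_u` — at a dyadic `u` this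
holds as soon as `x ∉ 𝔭_u`; the case `x = 1`, `m₁ = 1 + 4κ` gives unramifiedness at EVERY DYADIC `u`, split (`≡ 1 mod 8`) or inert (`≡ 5 mod 8`) alike; no hypothesis on
the local degree is needed.  (Design constraint (C5): when the planted prime is `2` the radicand lies in `𝔭_{v′}` and only the `x`-version applies off `v′`.)
(§3) LOCAL-TO-GLOBAL: `γ ∈ F` is of the form `1 + 4κ`, `κ ∈ 𝓞 F`, as soon as `|(γ − 1)∕4|_u ≤ 1` at every finite `u` (Mathlib `mem_integers_of_valuation_le_one`); for
`γ ∈ 𝓞 F` the condition is automatic off the dyadic places.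
* §1 `isUnramifiedIn_of_sq_eq_of_isSquare_adicCompletion`, **`isUnramifiedAt_of_sq_eq_of_isSquare_adicCompletion`**.
* §2 (the `x`-VERSION, dealer 00:47:38Z: `δ² = m₁`, `x² − m₁ ∈ (4)`, `θ := (x + δ)∕2`, `minpoly = X² − x X + (x² − m₁)∕4`, `f′(θ) = 2θ − x = δ`) `half_add_not_mem_range`,
  `half_add_sq_sub`, `isIntegral_half_add`, `minpoly_half_add`, `minpoly_ringOfIntegers_half_add`, `two_mul_sub_mem_differentIdeal`,
  **`isUnramifiedAt_of_sq_eq_of_sq_sub_mem_span_four`** (+ `IsUnramifiedIn` twin, dyadic corollary `…_of_two_mem` with `x ∉ 𝔭_u`), and the `x = 1` corollaries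
  **`isUnramifiedAt_of_sq_eq_one_add_four_mul`**, `isUnramifiedAt_of_sq_eq_one_add_four_mul_of_two_mem`, `isUnramifiedIn_of_sq_eq_one_add_four_mul_of_two_mem`.
* §3 `exists_eq_one_add_four_mul_of_valuation_le`, `valuation_sub_one_div_four_le_one_of_two_not_mem`.

HONEST LABEL: HC_CM is proved only modulo the 7 printed citations (2 remaining named inputs: hLiu418 = stmt-HodgeConjecture-24832, h413 =
stmt-HodgeConjecture-24833) until rung 0 closes; infrastructure toward the GENUINE residual (U3-F); proves nothing printed; count-neutral.

## References
* [Neukirch1999] J. Neukirch, *Algebraic Number Theory*, Grundlehren 322 (1999), Ch. III §2 Thm. (2.6), (2.4)–(2.5); Ch. II (7.13).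
* [SerreLocalFields1979] J.-P. Serre, *Local Fields*, GTM 67 (1979), Ch. III §6.
* [Omeara1963] O. T. O'Meara, *Introduction to Quadratic Forms* (1963), §63A (dyadic unit square classes), §65A.
-/

set_option autoImplicit false
-- the mandated namespace repeats the single-problem summit's segment (`HodgeConjecture.HodgeConjecture`)
set_option linter.dupNamespace false

noncomputable section

namespace Summit.HodgeConjecture.HodgeConjecture.R90.S3

open NumberField IsDedekindDomain Polynomial
open Literature.NumberTheory.NumberFields Literature.NumberTheory.GaloisRepresentations
open Literature.NumberTheory.Automorphic Literature.NumberTheory.Automorphic.UnitaryGroup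

variable {F : Type} (E : Type) [Field F] [NumberField F] [Field E] [NumberField E] [Algebra F E]

/-! ## §1 A radicand that is a local square at `u`: `u` splits, hence is unramified (any `u`, dyadic included) -/

/-- **`m` a square in `F_u` ⇒ `u` is unramified in `E = F(√m)`** (`Algebra.IsUnramifiedIn`): `u` even splits completely (★ `mem_splitPrimes_of_isSquare_adicCompletion`).
[cite: Omeara1963, §65A] [cite: Neukirch1999, Ch. III §2 Thm. (2.6)] -/
theorem isUnramifiedIn_of_sq_eq_of_isSquare_adicCompletion [Algebra.IsQuadraticExtension F E] (u : HeightOneSpectrum (𝓞 F)) {δ : E} {m : F}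
    (hm : δ ^ 2 = algebraMap F E m) (hδF : δ ∉ (algebraMap F E).range) (hsq : IsSquare (algebraMap F (u.adicCompletion F) m)) :
    Algebra.IsUnramifiedIn (𝓞 E) u.asIdeal :=
  (QuadraticExtension.mem_splitPrimes_of_isSquare_adicCompletion hm (fun r hr => hδF ⟨r, hr⟩) u hsq).1

/-- **`m` a square in `F_u` ⇒ `E = F(√m)` is unramified at every place `W ∣ u`** (socket currency `Algebra.IsUnramifiedAt (𝓞 F) W.1.asIdeal`); at a dyadic `u` with
`F_u ≅ ℚ₂` this is the unit class `m ≡ 1 (mod 8)`. [cite: Omeara1963, §63A, §65A] [cite: Neukirch1999, Ch. III §2 Thm. (2.6)] -/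
theorem isUnramifiedAt_of_sq_eq_of_isSquare_adicCompletion [Algebra.IsQuadraticExtension F E] (u : HeightOneSpectrum (𝓞 F)) (W : PlacesOver E u)
    {δ : E} {m : F} (hm : δ ^ 2 = algebraMap F E m) (hδF : δ ∉ (algebraMap F E).range) (hsq : IsSquare (algebraMap F (u.adicCompletion F) m)) :
    Algebra.IsUnramifiedAt (𝓞 F) W.1.asIdeal := by
  obtain ⟨W, rfl⟩ := W
  exact isUnramifiedIn_of_sq_eq_of_isSquare_adicCompletion E _ hm hδF hsq W.asIdeal W.isPrime ⟨rfl⟩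

/-! ## §2 The dyadic unit classes: `δ² = m₁` with `x² − m₁ ∈ (4)` ⇒ unramified at every `W ∣ u` with `m₁ ∉ 𝔭_u` (in particular `δ² = 1 + 4κ` at every dyadic `u`) -/

omit [NumberField F] in
/-- `(x + δ)∕2 ∉ F` when `δ ∉ F` (`x ∈ F`; characteristic `0`). [cite: Neukirch1999, Ch. II §8] -/
theorem half_add_not_mem_range (x : F) {δ : E} (hδF : δ ∉ (algebraMap F E).range) : (algebraMap F E x + δ) / 2 ∉ (algebraMap F E).range := by
  rintro ⟨r, hr⟩
  refine hδF ⟨2 * r - x, ?_⟩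
  have h2 : (2 : E) ≠ 0 := two_ne_zero
  rw [map_sub, map_mul, map_ofNat, hr]
  field_simp
  ring

omit [NumberField F] in
/-- `θ = (x + δ)∕2` is a root of `X² − x X + κ` when `δ² = m₁` and `x² − m₁ = 4κ` (characteristic `0`). [cite: Neukirch1999, Ch. I §2] -/
theorem half_add_sq_sub {δ : E} {x m₁ κ : F} (hδ : δ ^ 2 = algebraMap F E m₁) (hκ : x ^ 2 - m₁ = 4 * κ) :
    ((algebraMap F E x + δ) / 2) ^ 2 - algebraMap F E x * ((algebraMap F E x + δ) / 2) + algebraMap F E κ = 0 := by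
  have h2 : (2 : E) ≠ 0 := two_ne_zero
  have hκE : algebraMap F E x ^ 2 - algebraMap F E m₁ = 4 * algebraMap F E κ := by
    rw [← map_pow, ← map_sub, hκ, map_mul, map_ofNat]
  field_simp
  linear_combination hδ - hκE

omit [NumberField F] [NumberField E] in
/-- `X² − C a · X + C b` is monic. [folklore] -/
theorem monic_X_sq_sub_C_mul_X_add_C {R : Type*} [CommRing R] [Nontrivial R] (a b : R) : (X ^ 2 - C a * X + C b : R[X]).Monic := by
  have h : (X ^ 2 - C a * X + C b : R[X]) = X ^ 2 - (C a * X - C b) := by ring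
  rw [h]
  have hle : degree (C a * X - C b : R[X]) ≤ 1 :=
    (degree_sub_le _ _).trans (max_le ((degree_C_mul_X_le a)) (degree_C_le.trans zero_le_one))
  exact (monic_X_pow 2).sub_of_left (hle.trans_lt (by rw [degree_X_pow]; norm_num))

omit [NumberField F] [NumberField E] in
/-- `natDegree (X² − C a · X + C b) ≤ 2`. [folklore] -/
theorem natDegree_X_sq_sub_C_mul_X_add_C_le {R : Type*} [CommRing R] [Nontrivial R] (a b : R) : (X ^ 2 - C a * X + C b : R[X]).natDegree ≤ 2 := by
  refine (natDegree_add_le _ _).trans (max_le ((natDegree_sub_le _ _).trans (max_le ?_ ?_)) ?_)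
  · rw [natDegree_X_pow]
  · exact (natDegree_C_mul_le a X).trans (natDegree_X_le.trans one_le_two)
  · rw [natDegree_C]; exact Nat.zero_le _

omit [NumberField F] in
/-- `θ = (x + δ)∕2` is an algebraic integer when `δ² = m₁`, `x² − m₁ = 4κ` with `x, m₁, κ ∈ 𝓞 F` (root of the monic `X² − x X + κ ∈ 𝓞 F[X]`). [cite: Neukirch1999, Ch. I §2] -/
theorem isIntegral_half_add {δ : E} (x m₁ κ : 𝓞 F) (hδ : δ ^ 2 = algebraMap F E (m₁ : F)) (hκ : x ^ 2 - m₁ = 4 * κ) :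
    IsIntegral ℤ ((algebraMap F E (x : F) + δ) / 2) := by
  have hκF : (x : F) ^ 2 - (m₁ : F) = 4 * (κ : F) := by
    have h := congrArg (algebraMap (𝓞 F) F) hκ
    rw [map_sub, map_pow, map_mul, map_ofNat] at h
    exact h
  have hF : IsIntegral (𝓞 F) ((algebraMap F E (x : F) + δ) / 2) := by
    refine ⟨X ^ 2 - C x * X + C κ, monic_X_sq_sub_C_mul_X_add_C x κ, ?_⟩
    have h := half_add_sq_sub E hδ hκF
    simp only [eval₂_add, eval₂_sub, eval₂_mul, eval₂_X_pow, eval₂_X, eval₂_C]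
    rwa [IsScalarTower.algebraMap_apply (𝓞 F) F E, IsScalarTower.algebraMap_apply (𝓞 F) F E]
  exact isIntegral_trans _ hF

omit [NumberField F] in
/-- **`minpoly_F θ = X² − x X + κ`** for `θ = (x + δ)∕2`, `δ ∉ F`, `δ² = m₁`, `x² − m₁ = 4κ` (the minimal polynomial divides this monic quadratic and has degree `≥ 2`
since `θ ∉ F`). [cite: Neukirch1999, Ch. II §8] -/
theorem minpoly_half_add {δ : E} {x m₁ κ : F} (hδ : δ ^ 2 = algebraMap F E m₁) (hκ : x ^ 2 - m₁ = 4 * κ) (hδF : δ ∉ (algebraMap F E).range) :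
    minpoly F ((algebraMap F E x + δ) / 2) = X ^ 2 - C x * X + C κ := by
  have hroot : aeval ((algebraMap F E x + δ) / 2) (X ^ 2 - C x * X + C κ : F[X]) = 0 := by
    simpa only [map_add, map_sub, map_mul, map_pow, aeval_X, aeval_C] using half_add_sq_sub E hδ hκ
  have hint : IsIntegral F ((algebraMap F E x + δ) / 2) := ⟨X ^ 2 - C x * X + C κ, monic_X_sq_sub_C_mul_X_add_C x κ, hroot⟩
  have hdvd : minpoly F ((algebraMap F E x + δ) / 2) ∣ X ^ 2 - C x * X + C κ := minpoly.dvd F _ hroot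
  have h2 : 2 ≤ (minpoly F ((algebraMap F E x + δ) / 2)).natDegree := (minpoly.two_le_natDegree_iff hint).2 (half_add_not_mem_range E x hδF)
  exact (eq_of_monic_of_dvd_of_natDegree_le (minpoly.monic hint) (monic_X_sq_sub_C_mul_X_add_C x κ) hdvd
    ((natDegree_X_sq_sub_C_mul_X_add_C_le x κ).trans h2)).symm

/-- **`minpoly_{𝓞 F} θ₀ = X² − x X + κ`** for the algebraic integer `θ₀ = (x + δ)∕2` (`𝓞 F` integrally closed: Mathlib `minpoly.isIntegrallyClosed_eq_field_fractions`).
[cite: Neukirch1999, Ch. I §2] -/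
theorem minpoly_ringOfIntegers_half_add (θ₀ : 𝓞 E) {δ : E} (x m₁ κ : 𝓞 F) (hθ₀ : (θ₀ : E) = (algebraMap F E (x : F) + δ) / 2)
    (hδ : δ ^ 2 = algebraMap F E (m₁ : F)) (hκ : x ^ 2 - m₁ = 4 * κ) (hδF : δ ∉ (algebraMap F E).range) :
    minpoly (𝓞 F) θ₀ = X ^ 2 - C x * X + C κ := by
  have hκF : (x : F) ^ 2 - (m₁ : F) = 4 * (κ : F) := by
    have h := congrArg (algebraMap (𝓞 F) F) hκ
    rw [map_sub, map_pow, map_mul, map_ofNat] at h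
    exact h
  have hint : IsIntegral (𝓞 F) θ₀ := Algebra.IsIntegral.isIntegral θ₀
  have h := minpoly.isIntegrallyClosed_eq_field_fractions F E hint
  rw [show algebraMap (𝓞 E) E θ₀ = (θ₀ : E) from rfl, hθ₀, minpoly_half_add E hδ hκF hδF] at h
  apply Polynomial.map_injective (algebraMap (𝓞 F) F) (FaithfulSMul.algebraMap_injective (𝓞 F) F)
  rw [← h]
  simp only [Polynomial.map_add, Polynomial.map_sub, Polynomial.map_mul, Polynomial.map_pow, map_X, map_C]

/-- **`δ = 2θ₀ − x ∈ 𝔇(𝓞 E ∕ 𝓞 F)`**: the different contains `f′(θ₀)` for the integral generator `θ₀ = (x + δ)∕2` of `E = F(θ₀)`, `f = minpoly_{𝓞 F} θ₀ = X² − x X + κ`,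
`f′ = 2X − x` (Mathlib `aeval_derivative_mem_differentIdeal`). [cite: Neukirch1999, Ch. III §2 (2.4)–(2.5)] [cite: SerreLocalFields1979, Ch. III §6] -/
theorem two_mul_sub_mem_differentIdeal [Algebra.IsQuadraticExtension F E] (θ₀ : 𝓞 E) {δ : E} (x m₁ κ : 𝓞 F)
    (hθ₀ : (θ₀ : E) = (algebraMap F E (x : F) + δ) / 2) (hδ : δ ^ 2 = algebraMap F E (m₁ : F)) (hκ : x ^ 2 - m₁ = 4 * κ)
    (hδF : δ ∉ (algebraMap F E).range) :
    2 * θ₀ - algebraMap (𝓞 F) (𝓞 E) x ∈ differentIdeal (𝓞 F) (𝓞 E) := by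
  have hgen : Algebra.adjoin F {(θ₀ : E)} = ⊤ := by
    rw [hθ₀]
    exact adjoin_eq_top_of_not_mem_range E (half_add_not_mem_range E (x : F) hδF)
  have h := aeval_derivative_mem_differentIdeal (𝓞 F) F E θ₀ hgen
  rw [minpoly_ringOfIntegers_half_add E θ₀ x m₁ κ hθ₀ hδ hκ hδF] at h
  have hd : aeval θ₀ (derivative (X ^ 2 - C x * X + C κ : (𝓞 F)[X])) = 2 * θ₀ - algebraMap (𝓞 F) (𝓞 E) x := by
    simp only [derivative_X_pow, derivative_mul, derivative_X, derivative_C, zero_mul, zero_add, mul_one, add_zero, map_add, map_sub, map_mul,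
      aeval_X, aeval_C, Nat.cast_ofNat, map_ofNat, Nat.add_one_sub_one, pow_one]
  rwa [hd] at h

/-- **`E = F(δ)`, `δ² = m₁`, `x² − m₁ ∈ (4)` (`x, m₁ ∈ 𝓞 F`) IS UNRAMIFIED AT EVERY `W ∣ u` WITH `m₁ ∉ 𝔭_u`** (`Algebra.IsUnramifiedAt (𝓞 F) 𝔓_W`) — the
`x`-VERSION (dealer 00:41:30Z (2) ∕ 00:47:38Z, design constraint (C5): when the planted prime is `2` no global `γ·□ = 1 + 4κ` need exist, but an `x ≡ 0`
on the `v′`-part, `≡ 1` elsewhere does).  By Mathlib `not_dvd_differentIdeal_iff` it suffices that `𝔓_W ∤ 𝔇`; but `δ = 2θ₀ − x ∈ 𝔇` (`two_mul_sub_mem_differentIdeal`),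
so `𝔓_W ∣ 𝔇` would give `δ² = m₁ ∈ 𝔓_W ∩ 𝓞 F = 𝔭_u`.  (Separability on the abstract fraction fields transported from `E ∕ F` as in ★ `isUnramifiedAt_of_sq_eq_of_not_mem`.)
[cite: Neukirch1999, Ch. III §2 Thm. (2.6)] [cite: SerreLocalFields1979, Ch. III §6] [cite: Omeara1963, §63A] -/
theorem isUnramifiedAt_of_sq_eq_of_sq_sub_mem_span_four [Algebra.IsQuadraticExtension F E] (u : HeightOneSpectrum (𝓞 F)) (W : PlacesOver E u) {δ : E}
    (x m₁ : 𝓞 F) (hδ : δ ^ 2 = algebraMap F E (m₁ : F)) (hδF : δ ∉ (algebraMap F E).range)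
    (hx : x ^ 2 - m₁ ∈ Ideal.span {(4 : 𝓞 F)}) (hu : m₁ ∉ u.asIdeal) :
    Algebra.IsUnramifiedAt (𝓞 F) W.1.asIdeal := by
  obtain ⟨κ, hκ⟩ := Ideal.mem_span_singleton.1 hx
  let θ₀ : 𝓞 E := ⟨(algebraMap F E (x : F) + δ) / 2, isIntegral_half_add E x m₁ κ hδ hκ⟩
  have hθ₀ : (θ₀ : E) = (algebraMap F E (x : F) + δ) / 2 := rfl
  have hD : 2 * θ₀ - algebraMap (𝓞 F) (𝓞 E) x ∈ differentIdeal (𝓞 F) (𝓞 E) := two_mul_sub_mem_differentIdeal E θ₀ x m₁ κ hθ₀ hδ hκ hδF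
  -- the compatible algebra structure on the abstract fraction fields (Mathlib keeps it non-instance) and separability (char. 0)
  letI : Algebra (FractionRing (𝓞 F)) (FractionRing (𝓞 E)) := FractionRing.liftAlgebra _ _
  haveI : Algebra.IsSeparable (FractionRing (𝓞 F)) (FractionRing (𝓞 E)) := by
    refine Algebra.IsSeparable.of_equiv_equiv (FractionRing.algEquiv (𝓞 F) F).symm.toRingEquiv
      (FractionRing.algEquiv (𝓞 E) E).symm.toRingEquiv ?_
    ext y
    exact IsFractionRing.algEquiv_commutes (FractionRing.algEquiv (𝓞 F) F).symm (FractionRing.algEquiv (𝓞 E) E).symm _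
  refine not_dvd_differentIdeal_iff.1 fun hdvd => ?_
  have hδW : 2 * θ₀ - algebraMap (𝓞 F) (𝓞 E) x ∈ W.1.asIdeal := (Ideal.le_of_dvd hdvd) hD
  -- square it: `δ² = m₁ ∈ 𝔓_W ∩ 𝓞 F = 𝔭_u`
  have hsq : algebraMap (𝓞 F) (𝓞 E) m₁ ∈ W.1.asIdeal := by
    have heq : algebraMap (𝓞 F) (𝓞 E) m₁ = (2 * θ₀ - algebraMap (𝓞 F) (𝓞 E) x) * (2 * θ₀ - algebraMap (𝓞 F) (𝓞 E) x) := by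
      apply RingOfIntegers.ext
      have e1 : ((algebraMap (𝓞 F) (𝓞 E) m₁ : 𝓞 E) : E) = algebraMap F E (m₁ : F) := by
        rw [RingOfIntegers.coe_eq_algebraMap, ← IsScalarTower.algebraMap_apply, IsScalarTower.algebraMap_apply (𝓞 F) F E]
      have ex : ((algebraMap (𝓞 F) (𝓞 E) x : 𝓞 E) : E) = algebraMap F E (x : F) := by
        rw [RingOfIntegers.coe_eq_algebraMap, ← IsScalarTower.algebraMap_apply, IsScalarTower.algebraMap_apply (𝓞 F) F E]
      have e2 : ((((2 * θ₀ - algebraMap (𝓞 F) (𝓞 E) x) * (2 * θ₀ - algebraMap (𝓞 F) (𝓞 E) x)) : 𝓞 E) : E) =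
          (2 * ((algebraMap F E (x : F) + δ) / 2) - algebraMap F E (x : F)) * (2 * ((algebraMap F E (x : F) + δ) / 2) - algebraMap F E (x : F)) := by
        simp only [map_mul, map_sub, map_ofNat, ex, θ₀, RingOfIntegers.map_mk]
      rw [e1, e2, ← hδ]
      ring
    rw [heq]
    exact Ideal.mul_mem_left _ _ hδW
  have hva : u.asIdeal = Ideal.comap (algebraMap (𝓞 F) (𝓞 E)) W.1.asIdeal := (PlacesOver.liesOver W).over
  exact hu (by rw [hva, Ideal.mem_comap]; exact hsq)

/-- `Algebra.IsUnramifiedIn` twin of `isUnramifiedAt_of_sq_eq_of_sq_sub_mem_span_four`. [cite: Neukirch1999, Ch. III §2 Thm. (2.6)] -/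
theorem isUnramifiedIn_of_sq_eq_of_sq_sub_mem_span_four [Algebra.IsQuadraticExtension F E] (u : HeightOneSpectrum (𝓞 F)) {δ : E}
    (x m₁ : 𝓞 F) (hδ : δ ^ 2 = algebraMap F E (m₁ : F)) (hδF : δ ∉ (algebraMap F E).range)
    (hx : x ^ 2 - m₁ ∈ Ideal.span {(4 : 𝓞 F)}) (hu : m₁ ∉ u.asIdeal) :
    Algebra.IsUnramifiedIn (𝓞 E) u.asIdeal := by
  intro P hP hlo
  have hPbot : P ≠ ⊥ := Ideal.ne_bot_of_liesOver_of_ne_bot u.ne_bot P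
  exact isUnramifiedAt_of_sq_eq_of_sq_sub_mem_span_four E u ⟨⟨P, hP, hPbot⟩, HeightOneSpectrum.ext hlo.over.symm⟩ x m₁ hδ hδF hx hu

omit [NumberField F] [NumberField E] in
/-- At a DYADIC place (`2 ∈ 𝔭_u`), `x² − m₁ ∈ (4)` and `x ∉ 𝔭_u` force `m₁ ∉ 𝔭_u`. [folklore] -/
theorem not_mem_of_sq_sub_mem_span_four_of_two_mem (u : HeightOneSpectrum (𝓞 F)) {x m₁ : 𝓞 F} (hx : x ^ 2 - m₁ ∈ Ideal.span {(4 : 𝓞 F)})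
    (h2 : (2 : 𝓞 F) ∈ u.asIdeal) (hxu : x ∉ u.asIdeal) : m₁ ∉ u.asIdeal := by
  intro hm
  obtain ⟨κ, hκ⟩ := Ideal.mem_span_singleton.1 hx
  have h4 : x ^ 2 - m₁ ∈ u.asIdeal := by
    rw [hκ, show (4 : 𝓞 F) * κ = 2 * (2 * κ) by ring]
    exact Ideal.mul_mem_right _ _ h2
  have hx2 : x ^ 2 ∈ u.asIdeal := by
    have := Ideal.add_mem _ h4 hm
    rwa [sub_add_cancel] at this
  exact hxu (u.isPrime.mem_of_pow_mem 2 hx2)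

/-- **Dyadic corollary of the `x`-version**: `2 ∈ 𝔭_u`, `x ∉ 𝔭_u` ⇒ unramified at every `W ∣ u`. [cite: Omeara1963, §63A] [cite: Neukirch1999, Ch. III §2 Thm. (2.6)] -/
theorem isUnramifiedAt_of_sq_eq_of_sq_sub_mem_span_four_of_two_mem [Algebra.IsQuadraticExtension F E] (u : HeightOneSpectrum (𝓞 F)) (W : PlacesOver E u)
    {δ : E} (x m₁ : 𝓞 F) (hδ : δ ^ 2 = algebraMap F E (m₁ : F)) (hδF : δ ∉ (algebraMap F E).range)
    (hx : x ^ 2 - m₁ ∈ Ideal.span {(4 : 𝓞 F)}) (h2 : (2 : 𝓞 F) ∈ u.asIdeal) (hxu : x ∉ u.asIdeal) :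
    Algebra.IsUnramifiedAt (𝓞 F) W.1.asIdeal :=
  isUnramifiedAt_of_sq_eq_of_sq_sub_mem_span_four E u W x m₁ hδ hδF hx (not_mem_of_sq_sub_mem_span_four_of_two_mem u hx h2 hxu)

omit [NumberField F] [NumberField E] in
/-- At a DYADIC place (`2 ∈ 𝔭_u`), `1 + 4κ ∉ 𝔭_u` automatically. [folklore] -/
theorem one_add_four_mul_not_mem_of_two_mem (u : HeightOneSpectrum (𝓞 F)) (κ : 𝓞 F) (h2 : (2 : 𝓞 F) ∈ u.asIdeal) :
    (1 + 4 * κ : 𝓞 F) ∉ u.asIdeal := by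
  refine not_mem_of_sq_sub_mem_span_four_of_two_mem u (x := 1) (Ideal.mem_span_singleton.2 ⟨-κ, by ring⟩) h2 ?_
  exact fun h1 => u.isPrime.ne_top ((Ideal.eq_top_iff_one _).2 (by simpa using h1))

/-- **The `1 + 4κ` form (`x = 1`)**: `δ² = 1 + 4κ`, `κ ∈ 𝓞 F` ⇒ `E = F(δ)` is unramified at every `W ∣ u` with `1 + 4κ ∉ 𝔭_u`.
[cite: Neukirch1999, Ch. III §2 Thm. (2.6)] -/
theorem isUnramifiedAt_of_sq_eq_one_add_four_mul [Algebra.IsQuadraticExtension F E] (u : HeightOneSpectrum (𝓞 F)) (W : PlacesOver E u) {δ : E} (κ : 𝓞 F)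
    (hδ : δ ^ 2 = 1 + 4 * algebraMap F E (κ : F)) (hδF : δ ∉ (algebraMap F E).range) (hu : (1 + 4 * κ : 𝓞 F) ∉ u.asIdeal) :
    Algebra.IsUnramifiedAt (𝓞 F) W.1.asIdeal := by
  refine isUnramifiedAt_of_sq_eq_of_sq_sub_mem_span_four E u W 1 (1 + 4 * κ) ?_ hδF (Ideal.mem_span_singleton.2 ⟨-κ, by ring⟩) hu
  change δ ^ 2 = algebraMap F E (algebraMap (𝓞 F) F (1 + 4 * κ))
  rw [hδ, map_add, map_one, map_mul, map_ofNat, map_add, map_one, map_mul, map_ofNat]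

/-- **THE DYADIC HALF OF ⟪U⟫-field**: `E = F(δ)` with `δ² = 1 + 4κ`, `κ ∈ 𝓞 F`, is UNRAMIFIED AT EVERY PLACE `W` over EVERY DYADIC `u` — the unit classes `1` and `5 (mod 8)`
at a dyadic place of degree one over `ℚ₂` (split resp. inert), audit1 S3#71 (B). [cite: Omeara1963, §63A] [cite: Neukirch1999, Ch. III §2 Thm. (2.6)] -/
theorem isUnramifiedAt_of_sq_eq_one_add_four_mul_of_two_mem [Algebra.IsQuadraticExtension F E] (u : HeightOneSpectrum (𝓞 F)) (W : PlacesOver E u)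
    {δ : E} (κ : 𝓞 F) (hδ : δ ^ 2 = 1 + 4 * algebraMap F E (κ : F)) (hδF : δ ∉ (algebraMap F E).range) (h2 : (2 : 𝓞 F) ∈ u.asIdeal) :
    Algebra.IsUnramifiedAt (𝓞 F) W.1.asIdeal :=
  isUnramifiedAt_of_sq_eq_one_add_four_mul E u W κ hδ hδF (one_add_four_mul_not_mem_of_two_mem u κ h2)

/-- `Algebra.IsUnramifiedIn` form of the dyadic half. [cite: Neukirch1999, Ch. III §2 Thm. (2.6)] -/
theorem isUnramifiedIn_of_sq_eq_one_add_four_mul_of_two_mem [Algebra.IsQuadraticExtension F E] (u : HeightOneSpectrum (𝓞 F))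
    {δ : E} (κ : 𝓞 F) (hδ : δ ^ 2 = 1 + 4 * algebraMap F E (κ : F)) (hδF : δ ∉ (algebraMap F E).range) (h2 : (2 : 𝓞 F) ∈ u.asIdeal) :
    Algebra.IsUnramifiedIn (𝓞 E) u.asIdeal := by
  intro P hP hlo
  have hPbot : P ≠ ⊥ := Ideal.ne_bot_of_liesOver_of_ne_bot u.ne_bot P
  exact isUnramifiedAt_of_sq_eq_one_add_four_mul_of_two_mem E u ⟨⟨P, hP, hPbot⟩, HeightOneSpectrum.ext hlo.over.symm⟩ κ hδ hδF h2

/-! ## §3 Local-to-global: `γ = 1 + 4κ` with `κ ∈ 𝓞 F` from the valuations of `(γ − 1)∕4` -/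

/-- **`γ = 1 + 4κ` for some `κ ∈ 𝓞 F`** as soon as `|(γ − 1)∕4|_u ≤ 1` at every finite place `u` (Mathlib `mem_integers_of_valuation_le_one`). [cite: Neukirch1999, Ch. I §3] -/
theorem exists_eq_one_add_four_mul_of_valuation_le {γ : F} (h : ∀ u : HeightOneSpectrum (𝓞 F), u.valuation F ((γ - 1) / 4) ≤ 1) :
    ∃ κ : 𝓞 F, γ = 1 + 4 * (κ : F) := by
  obtain ⟨κ, hκ⟩ := HeightOneSpectrum.mem_integers_of_valuation_le_one F ((γ - 1) / 4) h
  refine ⟨κ, ?_⟩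
  have h4 : (4 : F) ≠ 0 := by norm_num
  have hκ' : (κ : F) = (γ - 1) / 4 := hκ
  rw [hκ']
  field_simp
  ring

/-- Off the dyadic places the condition of `exists_eq_one_add_four_mul_of_valuation_le` is automatic for `γ ∈ 𝓞 F`: if `2 ∉ 𝔭_u` then `|(γ − 1)∕4|_u ≤ 1`
(`|4|_u = 1`). [cite: Neukirch1999, Ch. I §3] -/
theorem valuation_sub_one_div_four_le_one_of_two_not_mem (u : HeightOneSpectrum (𝓞 F)) (γ : 𝓞 F) (h2 : (2 : 𝓞 F) ∉ u.asIdeal) :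
    u.valuation F ((((γ : F)) - 1) / 4) ≤ 1 := by
  have h4mem : (4 : 𝓞 F) ∉ u.asIdeal := by
    intro h
    have h22 : (4 : 𝓞 F) = 2 * 2 := by norm_num
    rw [h22] at h
    rcases u.isPrime.mem_or_mem h with h | h <;> exact h2 h
  have h4 : u.valuation F (4 : F) = 1 := by
    rw [← map_ofNat (algebraMap (𝓞 F) F) 4, HeightOneSpectrum.valuation_of_algebraMap]
    exact HeightOneSpectrum.intValuation_eq_one_iff.2 h4mem
  have hsub : ((γ : F)) - 1 = algebraMap (𝓞 F) F (γ - 1) := by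
    rw [map_sub, map_one, RingOfIntegers.coe_eq_algebraMap]
  rw [map_div₀, h4, div_one, hsub, HeightOneSpectrum.valuation_of_algebraMap]
  exact HeightOneSpectrum.intValuation_le_one u _

end Summit.HodgeConjecture.HodgeConjecture.R90.S3

end
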